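import Summits.AtomisticToContinuum.Crystallization.Theses.IsometryAtoms

/-!
# Negative knowledge for crux `AtomicLawChargesCrystal` (stmt-AtomisticToContinuum-15778):
# the relative-density (cohesion / Delone) clause is LOAD-BEARING

`IsometryAtoms.AtomicLawChargesCrystal` (the bridge "an atom modulo isometry of a point-stationary
hard-core law charges every window of ONE periodic configuration") carries the hypothesis that
`P`-a.s. the configuration is relatively dense.  Deleting that single hypothesis makes the statement
FALSE already at the most degenerate witness, the one-point law `δ_{δ_0}` (tree facts
`isPointStationaryLaw_dirac_dirac_zero`, `isRootedHardCore_dirac_zero`): it is a probability law,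
a.s. `δ`-hard-core for every `δ`, point-stationary, and an atom modulo isometry at `Y = {0}`
(`count|{0} = δ_0`), but for every `Q : PeriodicConfiguration 3` the two-way matching event at
radius `R = ‖g‖` and tolerance `ε = ‖g‖ / 4`, `g ≠ 0` a period of `Q`, asks for a particle within `ε`
of `A g` — at distance `≥ 3ε` from the origin — which `δ_0` does not have: the event is contained in
the measurable set `{μ | μ (closedBall 0 ε)ᶜ ≠ 0}`, null for `δ_{δ_0}`.

So any proof of the crux must use relative density (the route's own single-layer law is the
non-degenerate witness of the same phenomenon; this file certifies the cheapest one).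
Supports item stmt-AtomisticToContinuum-15778 (refuter crux-attack, vetting sweep).
-/

noncomputable section

open MeasureTheory
open scoped ENNReal

namespace Summit.AtomisticToContinuum.Crystallization.Theorems.AtomicLawChargesCrystal.Negative.FalseWithoutRelDense

open Literature.Probability.Process
open Literature.MathematicalPhysics.StatisticalMechanics

/-- Euclidean 3-space (notation only, no new declaration). -/
local notation "E3" => EuclideanSpace ℝ (Fin 3)

/-- A periodic configuration of `ℝ³` has a non-zero period (its lattice spans `ℝ³`). [folklore] -/
theorem exists_ne_zero_mem_lattice (Q : PeriodicConfiguration 3) :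
    ∃ g ∈ Q.lattice, g ≠ (0 : E3) := by
  by_contra! h
  have hsub : (Q.lattice : Set E3) ⊆ {0} := fun g hg => h g hg
  have htop : Submodule.span ℝ (Q.lattice : Set E3) = ⊤ := Q.isZLattice.span_top
  have hle : (⊤ : Submodule ℝ E3) ≤ Submodule.span ℝ ({0} : Set E3) :=
    htop ▸ Submodule.span_mono hsub
  rw [Submodule.span_zero_singleton, top_le_iff] at hle
  have hne : (EuclideanSpace.single (0 : Fin 3) (1 : ℝ) : E3) ≠ 0 := by
    intro h0
    have := congrArg (fun v : E3 => v 0) h0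
    simp at this
  have hmem : (EuclideanSpace.single (0 : Fin 3) (1 : ℝ) : E3) ∈ (⊥ : Submodule ℝ E3) :=
    hle ▸ Submodule.mem_top
  exact hne ((Submodule.mem_bot ℝ).1 hmem)

/-- The one-point configuration `δ_0` is the rooted isometry class of `Y = {0}` seen through any
linear isometry: `δ_0 = count|(A '' ({0} - 0))`. [folklore] -/
theorem dirac_zero_mem_isometryClass_singleton :
    (Measure.dirac (0 : E3) : Measure E3) ∈ {μ : Measure E3 | ∃ A : E3 →ₗᵢ[ℝ] E3,
      ∃ q ∈ ({0} : Set E3), μ = (Measure.count : Measure E3).restrict ((fun s => A (s - q)) '' {0})} := by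
  refine ⟨LinearIsometry.id, 0, rfl, ?_⟩
  rw [Set.image_singleton, sub_self, LinearIsometry.coe_id, id_eq, Measure.restrict_singleton,
    Measure.count_singleton, one_smul]

/-- **The relative-density clause of `AtomicLawChargesCrystal` is load-bearing**: the crux with its
hypothesis `(∀ᵐ μ ∂P, ∃ R₀, ∀ z, ∃ y, μ {y} ≠ 0 ∧ dist z y ≤ R₀)` deleted (everything else verbatim)
is false, witnessed by the one-point law `δ_{δ_0}` (point-stationary, hard-core, an
atom at `Y = {0}`, charging no window `(‖g‖, ‖g‖/4)` of any periodic `Q` with period `g ≠ 0`).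
[folklore] -/
theorem atomicLawChargesCrystal_false_without_relDense :
    ¬ (∀ δ : ℝ, 0 < δ → ∀ P : Measure (Measure E3), IsProbabilityMeasure P →
        (∀ᵐ μ ∂P, IsRootedHardCore δ μ) → IsPointStationaryLaw P →
        (∃ Y : Set E3, 0 < P {μ | ∃ A : E3 →ₗᵢ[ℝ] E3, ∃ q ∈ Y,
            μ = (Measure.count : Measure E3).restrict ((fun s => A (s - q)) '' Y)}) →
        ∃ Q : PeriodicConfiguration 3, ∀ R ε : ℝ, 0 < R → 0 < ε →
          0 < P {μ | ∃ A : E3 →ₗᵢ[ℝ] E3, ∃ q ∈ Q.points,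
            (∀ s ∈ Q.points, dist s q ≤ R → ∃ y : E3, μ {y} ≠ 0 ∧ dist y (A (s - q)) ≤ ε) ∧
            (∀ y : E3, μ {y} ≠ 0 → ‖y‖ ≤ R → ∃ s ∈ Q.points, dist y (A (s - q)) ≤ ε)}) := by
  intro h
  have hae : ∀ᵐ μ ∂(Measure.dirac (Measure.dirac (0 : E3)) : Measure (Measure E3)),
      μ = Measure.dirac 0 :=
    ae_dirac_dirac_zero (measurableSet_singleton (0 : E3))
  have hHC : ∀ᵐ μ ∂(Measure.dirac (Measure.dirac (0 : E3)) : Measure (Measure E3)),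
      IsRootedHardCore 1 μ :=
    hae.mono fun μ hμ => hμ ▸ isRootedHardCore_dirac_zero 1
  have hPS : IsPointStationaryLaw (Measure.dirac (Measure.dirac (0 : E3)) : Measure (Measure E3)) :=
    isPointStationaryLaw_dirac_dirac_zero
  have hAtom : ∃ Y : Set E3, 0 < (Measure.dirac (Measure.dirac (0 : E3)) : Measure (Measure E3))
      {μ | ∃ A : E3 →ₗᵢ[ℝ] E3, ∃ q ∈ Y,
        μ = (Measure.count : Measure E3).restrict ((fun s => A (s - q)) '' Y)} := by
    refine ⟨{0}, ?_⟩
    have hind : Set.indicator {μ : Measure E3 | ∃ A : E3 →ₗᵢ[ℝ] E3, ∃ q ∈ ({0} : Set E3),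
        μ = (Measure.count : Measure E3).restrict ((fun s => A (s - q)) '' {0})}
        (1 : Measure E3 → ℝ≥0∞) (Measure.dirac (0 : E3)) = 1 := by
      rw [Set.indicator_of_mem dirac_zero_mem_isometryClass_singleton, Pi.one_apply]
    calc (0 : ℝ≥0∞) < 1 := one_pos
      _ = _ := hind.symm
      _ ≤ _ := Measure.le_dirac_apply
  obtain ⟨Q, hQ⟩ := h 1 one_pos _ inferInstance hHC hPS hAtom
  obtain ⟨g, hg, hg0⟩ := exists_ne_zero_mem_lattice Q
  have hgpos : 0 < ‖g‖ := norm_pos_iff.2 hg0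
  obtain ⟨ε, hεdef⟩ : ∃ ε : ℝ, ε = ‖g‖ / 4 := ⟨_, rfl⟩
  have hε : 0 < ε := by rw [hεdef]; positivity
  have hpos := hQ ‖g‖ ε hgpos hε
  -- a measurable superset of the matching event that misses `δ_0`
  have hSc : MeasurableSet (Metric.closedBall (0 : E3) ε)ᶜ :=
    Metric.isClosed_closedBall.measurableSet.compl
  have hTmeas : MeasurableSet {μ : Measure E3 | μ (Metric.closedBall (0 : E3) ε)ᶜ ≠ 0} :=
    (Measure.measurable_coe hSc) (measurableSet_singleton (0 : ℝ≥0∞)).compl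
  have hsub : {μ : Measure E3 | ∃ A : E3 →ₗᵢ[ℝ] E3, ∃ q ∈ Q.points,
        (∀ s ∈ Q.points, dist s q ≤ ‖g‖ → ∃ y : E3, μ {y} ≠ 0 ∧ dist y (A (s - q)) ≤ ε) ∧
        (∀ y : E3, μ {y} ≠ 0 → ‖y‖ ≤ ‖g‖ → ∃ s ∈ Q.points, dist y (A (s - q)) ≤ ε)} ⊆
      {μ : Measure E3 | μ (Metric.closedBall (0 : E3) ε)ᶜ ≠ 0} := by
    rintro μ ⟨A, q, hq, h1, -⟩
    obtain ⟨y, hy, hdist⟩ :=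
      h1 (q + g) (Q.add_mem_points hq hg) (by rw [dist_eq_norm, add_sub_cancel_left])
    have hAg : ‖A (q + g - q)‖ = ‖g‖ := by rw [add_sub_cancel_left, A.norm_map]
    have htri : ‖A (q + g - q)‖ - ‖y‖ ≤ ‖A (q + g - q) - y‖ := norm_sub_norm_le _ _
    have hd : ‖A (q + g - q) - y‖ ≤ ε := by rwa [← dist_eq_norm, dist_comm]
    have hynorm : ε < ‖y‖ := by
      rw [hAg] at htri
      have h4 : ‖g‖ = 4 * ε := by rw [hεdef]; ring
      linarith
    have hyT : y ∈ (Metric.closedBall (0 : E3) ε)ᶜ := by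
      rw [Set.mem_compl_iff, Metric.mem_closedBall, dist_zero_right, not_le]
      exact hynorm
    intro hT0
    exact hy (measure_mono_null (Set.singleton_subset_iff.2 hyT) hT0)
  have hPT : (Measure.dirac (Measure.dirac (0 : E3)) : Measure (Measure E3))
      {μ : Measure E3 | μ (Metric.closedBall (0 : E3) ε)ᶜ ≠ 0} = 0 := by
    rw [Measure.dirac_apply' _ hTmeas, Set.indicator_of_notMem]
    simp only [Set.mem_setOf_eq, not_not]
    rw [Measure.dirac_apply' _ hSc, Set.indicator_of_notMem]
    rw [Set.mem_compl_iff, not_not, Metric.mem_closedBall, dist_self]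
    exact hε.le
  exact absurd (measure_mono_null hsub hPT) hpos.ne'

end Summit.AtomisticToContinuum.Crystallization.Theorems.AtomicLawChargesCrystal.Negative.FalseWithoutRelDense
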